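import Literature.Topology.CoveringSpaces.NormalSubgroupCovering
import Mathlib.Topology.Homotopy.Lifting
import Mathlib.Topology.Connected.LocallyPathConnected
import HarnessLib

/-!
# Every connected finite cover is dominated by a finite normal (quotient) cover

Topic `Literature/Topology/CoveringSpaces` — step (E) «Galois closure» of the topological Galois
correspondence for covering spaces (abc-iut cell, campaign-L R1, GAP row G-L4t14-R1; classical;
input of MEMO-geometric-EA-residual §2 item 2 «pass to a Galois cover dominating `𝕐 → 𝕏`»).

Setting: `X` path connected and strongly locally contractible (hence locally path connected,
Mathlib instance; e.g. a connected topological manifold), `x₀ : X`, the tree's universal cover `X̃ = UniversalCover X x₀`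
(`UniversalCover.lean`, `UniversalCoverLift.lean`) with its deck action of `π₁(X, x₀)`, and for a
subgroup `N` the orbit quotient `X̃ ⧸ N` with its projection `p̄ : X̃ ⧸ N → X`
(`NormalSubgroupCovering.lean`: a quotient covering map for `π₁(X, x₀) ⧸ N` when `N` is normal,
with finite fibres when `N` has finite index).  Let `p : E → X` be a covering map (Mathlib
`IsCoveringMap`) with `E` path connected, `e₀ ∈ p⁻¹{x₀}`, and FINITE fibre `p⁻¹{x₀}`.

Main results (A. Hatcher, *Algebraic Topology* (2002) §1.3: Prop. 1.33 lifting criterion, Prop. 1.36,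
Prop. 1.39 / Ex. 1.3.18–19 «normal covers»; the statement «a finite connected cover is dominated by
a finite regular cover» is folklore, e.g. the normal core argument):

* `ker_monodromyPerm_le_range_mapOfEq` — for ANY covering map, the kernel of the monodromy
  representation `π₁(X, x) →* Perm(p⁻¹{x})` (Mathlib `IsCoveringMap.monodromyPerm`) is contained
  in `p_* π₁(E, e)` for every `e` in the fibre (a loop acting trivially on the fibre lifts to a
  loop at `e`; the full stabiliser statement is `CoveringMonodromyStabilizer.lean`'s); it has
  finite index when the fibre is finite (Mathlib instance `Subgroup.finiteIndex_ker`).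
* `locallyPathConnectedSpace_of_isCoveringMap` — the total space of a covering map onto a locally
  path connected space is locally path connected (so Mathlib's lifting criterion applies to it).
* `UniversalCover.exists_map_orbitQuotient_of_le` — **domination**: for `N ⊴ π₁(X, x₀)` with
  `N ≤ ker (monodromyPerm)`, there is a continuous SURJECTION `f : X̃ ⧸ N → E` over `X`
  (`p ∘ f = p̄`) with `f [c] = e₀`; it is obtained from Mathlib's lifting criterion
  `IsCoveringMap.existsUnique_continuousMap_lifts_of_range_le` (`p̄_* π₁(X̃ ⧸ N) ⊆ N` is the
  tree's `fromPath_orbitLift_mem`), and surjectivity from path lifting in `X̃ ⧸ N` plus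
  uniqueness of path lifts in `E`.
* `UniversalCover.exists_map_orbitQuotient_ker_monodromyPerm` — the case `N := ker (monodromyPerm)`
  (normal, of finite index): a finite NORMAL cover of `X` dominating `E`.
* `exists_isQuotientCoveringMap_surjective_factor` — packaged: every path connected cover of `X`
  with a finite fibre is the continuous surjective image over `X` of the total space of a quotient
  covering map (Mathlib `IsQuotientCoveringMap`, i.e. a normal = regular = Galois cover) by a
  FINITE group, with path connected total space.

Design: proof-only (no `def`, no named fact); binder conventions of step (A)
(`CoveringMapFibreFunctor.lean`): unbundled `hp : IsCoveringMap p`, fibres `p ⁻¹' {x}`, Mathlib's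
`monodromy` / `monodromyPerm` / `FundamentalGroup.mapOfEq`.  Not here: that `f` is itself a
covering map, minimality of the normal closure (`ker` = normal core of `p_* π₁(E, e₀)`; this needs
`p_* π₁(E, e₀) = stabiliser`, step (B)), the deck group (step (B)/(D)).

## References
* A. Hatcher, *Algebraic Topology*, CUP 2002, §1.3, Prop. 1.33 (p. 61), Prop. 1.36 (pp. 68–69),
  Prop. 1.39 (pp. 70–71). [HatcherAT2002]
-/

noncomputable section

open Set Filter TopologicalSpace unitInterval MulAction Function
open _root_.Topology

namespace Literature.Topology.CoveringSpaces

universe u v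

/-! ### §1 Two general facts about covering maps -/

section General

variable {E : Type v} {X : Type u} [TopologicalSpace E] [TopologicalSpace X] {p : E → X}

/-- **A loop acting trivially on the fibre lifts to a loop**: if the monodromy of `γ ∈ π₁(X, x)`
fixes `e ∈ p⁻¹{x}`, then `γ ∈ p_* π₁(E, e)` (the lift of `γ` at `e` is a closed loop projecting to
`γ`).  This is the easy half of «`p_* π₁(E, e)` = stabiliser of `e`» (Hatcher Prop. 1.31; both halves:
`CoverMonodromy.mem_range_mapOfEq_iff_monodromy_eq` in `CoveringMonodromyStabilizer.lean`, kept
private here so that this file does not depend on that module's build); cf. Mathlib's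
`IsQuotientCoveringMap.ker_monodromyPerm` whose first half is this argument verbatim.
[cite: HatcherAT2002, §1.3 Prop. 1.31] -/
private theorem mem_range_mapOfEq_of_monodromy_eq (hp : IsCoveringMap p) {x : X} (e : p ⁻¹' {x})
    {γ : FundamentalGroup X x} (h : hp.monodromy γ e = e) :
    γ ∈ (FundamentalGroup.mapOfEq ⟨p, hp.continuous⟩ e.2).range := by
  refine ⟨(hp.liftPathQuotient γ e).cast rfl congr($h.symm), ?_⟩
  rw [FundamentalGroup.mapOfEq_apply, Path.Homotopic.Quotient.map_cast, hp.map_liftPathQuotient]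
  aesop

/-- **The kernel of the monodromy representation is contained in `p_* π₁(E, e)`** for every point
`e` of the fibre: `ker (π₁(X, x) →* Perm(p⁻¹{x})) ≤ range (π₁(E, e) → π₁(X, x))`.
[cite: HatcherAT2002, §1.3 Prop. 1.31] -/
theorem ker_monodromyPerm_le_range_mapOfEq (hp : IsCoveringMap p) {x : X} (e : p ⁻¹' {x}) :
    (hp.monodromyPerm x).ker ≤ (FundamentalGroup.mapOfEq ⟨p, hp.continuous⟩ e.2).range :=
  fun _ hγ ↦ mem_range_mapOfEq_of_monodromy_eq hp e (congrFun (congrArg (⇑) hγ) e)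

/-- Change of base point along an EQUALITY of points: the kernel of the monodromy representation is
invariant under `Path.cast` (bookkeeping for `p̄ [c] = x₀`, which holds propositionally only).
[folklore] -/
private theorem fromPath_cast_mem_ker_monodromyPerm_iff (hp : IsCoveringMap p) {x x' : X} (hx : x' = x)
    (γ : Path x x) :
    FundamentalGroup.fromPath (⟦γ.cast hx hx⟧ : Path.Homotopic.Quotient x' x') ∈
        (hp.monodromyPerm x').ker ↔
      FundamentalGroup.fromPath (⟦γ⟧ : Path.Homotopic.Quotient x x) ∈ (hp.monodromyPerm x).ker := by
  subst hx; rfl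

/-- **The total space of a covering map onto a locally path connected space is locally path
connected**: path connected neighbourhoods of `p e` inside the target of a chart of the local
homeomorphism `p` pull back, along the chart, to path connected neighbourhoods of `e`.  (General
local-homeomorphism form, by path components of the open pieces:
`Literature.AlgebraicGeometry.FundamentalGroup.locallyPathConnectedSpace_of_isLocalHomeomorph` in
`ZariskiOpenCoveringConnected.lean` — not imported here, to keep this file's imports topological.)
[cite: HatcherAT2002, §1.3, pp. 63–65 (a covering space of a locally path-connected space is locally path-connected, `p` being a local homeomorphism)] -/
theorem locallyPathConnectedSpace_of_isCoveringMap [LocallyPathConnectedSpace X]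
    (hp : IsCoveringMap p) : LocallyPathConnectedSpace E := by
  have hf : IsLocalHomeomorph p := hp.isLocalHomeomorph
  refine LocallyPathConnectedSpace.of_bases (p := fun e s ↦ s ∈ 𝓝 e ∧ IsPathConnected s)
    (s := fun _ s ↦ s)
    (fun e ↦ ⟨fun t ↦ ⟨fun ht ↦ ?_, fun ⟨s, ⟨hs, _⟩, hst⟩ ↦ mem_of_superset hs hst⟩⟩)
    (fun _ _ h ↦ h.2)
  -- a chart `h` of the local homeomorphism `p` at `e`
  obtain ⟨h, he, hph⟩ := hf e
  -- `h '' (h.source ∩ t)` is a neighbourhood of `h e`; shrink it to a path connected one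
  have hst : h.source ∩ t ∈ 𝓝 e := inter_mem (h.open_source.mem_nhds he) ht
  have himg : h '' (h.source ∩ t) ∈ 𝓝 (h e) := h.image_mem_nhds he hst
  obtain ⟨V, ⟨hVmem, hVpc⟩, hVsub⟩ := (path_connected_basis (h e)).mem_iff.mp himg
  -- `V ⊆ h.target`, so `h.symm` is continuous on `V` and `h.symm '' V` is path connected
  have hVt : V ⊆ h.target := fun y hy ↦ by
    obtain ⟨z, hz, rfl⟩ := hVsub hy
    exact h.map_source hz.1
  refine ⟨h.symm '' V, ⟨?_, hVpc.image' (h.continuousOn_symm.mono hVt)⟩, ?_⟩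
  · -- `h.symm '' V` is a neighbourhood of `e = h.symm (h e)`
    have h1 : h.symm '' V ∈ 𝓝 (h.symm (h e)) :=
      h.symm.image_mem_nhds (by rw [h.symm_source]; exact h.map_source he) hVmem
    rwa [h.left_inv he] at h1
  · rintro _ ⟨y, hy, rfl⟩
    obtain ⟨z, hz, rfl⟩ := hVsub hy
    rw [h.left_inv hz.1]
    exact hz.2

end General

/-! ### §2 The quotient `X̃ ⧸ N` dominates every path connected cover whose monodromy kills `N` -/

namespace UniversalCover

variable {X : Type u} [TopologicalSpace X] {x₀ : X} (N : Subgroup (FundamentalGroup X x₀))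
  {E : Type v} [TopologicalSpace E] {p : E → X}

/-- `X̃ ⧸ N` is locally path connected: a quotient of `X̃`, which is locally path connected as a
cover of `X` (`locallyPathConnectedSpace_of_isCoveringMap`; equivalently, via path connected tubes,
`UniversalCover.locallyPathConnectedSpace` of `UniversalCoverAssociatedCovering.lean`).
[cite: HatcherAT2002, §1.3 Prop. 1.36 (p. 68)] -/
theorem locallyPathConnectedSpace_orbitQuotient [PathConnectedSpace X]
    [StronglyLocallyContractibleSpace X] :
    LocallyPathConnectedSpace (orbitRel.Quotient N (UniversalCover X x₀)) :=
  haveI : LocallyPathConnectedSpace (UniversalCover X x₀) :=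
    locallyPathConnectedSpace_of_isCoveringMap isCoveringMap_proj
  inferInstance

section Domination

variable [N.Normal] {pbar : orbitRel.Quotient N (UniversalCover X x₀) → X}

/-- **Domination of a cover by the normal cover `X̃ ⧸ N`** (Hatcher Prop. 1.33 applied to
`p̄ : X̃ ⧸ N → X`, whose `p̄_* π₁` lies in `N` by Prop. 1.36): if `N ⊴ π₁(X, x₀)` acts trivially
on the fibre `p⁻¹{x₀}` of a covering map `p : E → X` (i.e. `N ≤ ker` of the monodromy
representation), then for every `e₀` over `x₀` there is a continuous map `f : X̃ ⧸ N → E` over `X`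
with `f [c] = e₀`; if moreover `E` is path connected, `f` is SURJECTIVE (every `e` is the endpoint of
a path from `e₀`, whose projection lifts to `X̃ ⧸ N`, and `f ∘` that lift is the lift to `E` by
uniqueness of path lifting). [cite: HatcherAT2002, §1.3 Prop. 1.33, Prop. 1.36] -/
theorem exists_map_orbitQuotient_of_le [PathConnectedSpace X] [StronglyLocallyContractibleSpace X]
    (hpbar : ∀ a, pbar (Quotient.mk _ a) = proj a)
    (hp : IsCoveringMap p) {e₀ : E} (he₀ : p e₀ = x₀) (hN : N ≤ (hp.monodromyPerm x₀).ker)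
    [PathConnectedSpace E] :
    ∃ f : C(orbitRel.Quotient N (UniversalCover X x₀), E),
      p ∘ f = pbar ∧ f (Quotient.mk _ (base X x₀)) = e₀ ∧ Function.Surjective f := by
  haveI := locallyPathConnectedSpace_orbitQuotient N (X := X) (x₀ := x₀)
  have hq : IsCoveringMap pbar := isCoveringMap_orbitLift N hpbar
  set a₀ : orbitRel.Quotient N (UniversalCover X x₀) := Quotient.mk _ (base X x₀)
  let F : C(orbitRel.Quotient N (UniversalCover X x₀), X) := ⟨pbar, hq.continuous⟩
  have hFa₀ : F a₀ = x₀ := hpbar (base X x₀)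
  have he : p e₀ = F a₀ := he₀.trans hFa₀.symm
  -- the lifting criterion: `p̄_* π₁(X̃ ⧸ N, a₀) ⊆ N ⊆ ker ⊆ p_* π₁(E, e₀)`
  have hle : (FundamentalGroup.map F a₀).range ≤
      (FundamentalGroup.mapOfEq ⟨p, hp.continuous⟩ he).range := by
    rintro _ ⟨δ, rfl⟩
    obtain ⟨δ, rfl⟩ := Path.Homotopic.Quotient.mk_surjective δ
    -- `F_* [δ] ∈ N ≤ ker`, by the tree's endpoint computation (stated at `x₀` through a cast)
    have hmem := hN (fromPath_orbitLift_mem N hpbar hq.continuous δ)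
    have hmem' : FundamentalGroup.fromPath (⟦δ.map hq.continuous⟧ :
        Path.Homotopic.Quotient (F a₀) (F a₀)) ∈ (hp.monodromyPerm (F a₀)).ker :=
      (fromPath_cast_mem_ker_monodromyPerm_iff hp _ (δ.map hq.continuous)).mp hmem
    exact ker_monodromyPerm_le_range_mapOfEq hp ⟨e₀, he⟩ hmem'
  obtain ⟨f, ⟨hfa₀, hpf⟩, -⟩ := hp.existsUnique_continuousMap_lifts_of_range_le he hle
  refine ⟨f, hpf, hfa₀, fun e ↦ ?_⟩
  -- surjectivity: lift `p ∘ δ` (δ a path from `e₀` to `e`) to `X̃ ⧸ N` from `a₀`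
  let δ : Path e₀ e := (PathConnectedSpace.somePath e₀ e)
  let γ : C(I, X) := (⟨p, hp.continuous⟩ : C(E, X)).comp δ.toContinuousMap
  have hγ0 : γ 0 = pbar a₀ := by
    change p (δ 0) = pbar a₀
    rw [δ.source, he₀]; exact hFa₀.symm
  obtain ⟨Γ, hΓ, hΓ0⟩ := hq.exists_path_lifts γ a₀ hγ0
  -- both `f ∘ Γ` and `δ` lift `γ` through `p` from `e₀`
  have hγe : γ 0 = p e₀ := by change p (δ 0) = p e₀; rw [δ.source]
  have h1 : (f.comp Γ : C(I, E)) = hp.liftPath γ e₀ hγe := by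
    refine (hp.eq_liftPath_iff' hγe).mpr ⟨?_, ?_⟩
    · funext t
      change p (f (Γ t)) = γ t
      rw [← hΓ]
      exact congrFun hpf (Γ t)
    · change f (Γ 0) = e₀
      rw [hΓ0, hfa₀]
  have h2 : (δ.toContinuousMap : C(I, E)) = hp.liftPath γ e₀ hγe :=
    (hp.eq_liftPath_iff' hγe).mpr ⟨rfl, δ.source⟩
  refine ⟨Γ 1, ?_⟩
  have := congrFun (congrArg (⇑) (h1.trans h2.symm)) 1
  -- `f (Γ 1) = δ 1 = e`
  simpa [δ.target] using this

end Domination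

/-- **Every path connected cover with finite fibre is dominated by a finite NORMAL cover**: with
`N := ker (π₁(X, x₀) →* Perm(p⁻¹{x₀}))` (normal, of finite index), the quotient covering
`p̄ : X̃ ⧸ N → X` (of the group `π₁(X, x₀) ⧸ N`, finite fibres — `NormalSubgroupCovering.lean`) maps
continuously ONTO `E` over `X`, sending the class of the base point to `e₀`.
[cite: HatcherAT2002, §1.3 Prop. 1.33, Prop. 1.36, Prop. 1.39] -/
theorem exists_map_orbitQuotient_ker_monodromyPerm [PathConnectedSpace X]
    [StronglyLocallyContractibleSpace X] (hp : IsCoveringMap p) {e₀ : E} (he₀ : p e₀ = x₀)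
    [PathConnectedSpace E]
    {pbar : orbitRel.Quotient (hp.monodromyPerm x₀).ker (UniversalCover X x₀) → X}
    (hpbar : ∀ a, pbar (Quotient.mk _ a) = proj a) :
    ∃ f : C(orbitRel.Quotient (hp.monodromyPerm x₀).ker (UniversalCover X x₀), E),
      p ∘ f = pbar ∧ f (Quotient.mk _ (base X x₀)) = e₀ ∧ Function.Surjective f :=
  exists_map_orbitQuotient_of_le _ hpbar hp he₀ le_rfl

end UniversalCover

/-! ### §3 Packaged statement -/

/-- **Galois closure of a finite connected cover (existence of a dominating finite normal cover)**:
for `X` path connected, locally path connected and strongly locally contractible, every covering map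
`p : E → X` with `E` path connected and a finite fibre `p⁻¹{x₀}` is dominated by a NORMAL cover with
FINITE group: there are a path connected space `Y`, a finite group `G` acting on `Y`, a quotient
covering map `q : Y → X` for `G` (Mathlib `IsQuotientCoveringMap`: `G` acts by deck transformations,
freely and transitively on the fibres) and a continuous surjection `f : Y → E` with `p ∘ f = q`.
Witness: `Y = X̃ ⧸ N`, `G = π₁(X, x₀) ⧸ N`, `N = ker` of the monodromy representation on `p⁻¹{x₀}`.
[cite: HatcherAT2002, §1.3 Prop. 1.36, Prop. 1.39] -/
theorem exists_isQuotientCoveringMap_surjective_factor {X : Type u} [TopologicalSpace X]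
    [PathConnectedSpace X] [StronglyLocallyContractibleSpace X]
    {E : Type v} [TopologicalSpace E] [PathConnectedSpace E] {p : E → X} (hp : IsCoveringMap p)
    (x₀ : X) [Finite (p ⁻¹' {x₀})] :
    ∃ (Y : Type u) (_ : TopologicalSpace Y) (G : Type u) (_ : Group G) (_ : MulAction G Y)
      (q : Y → X) (f : Y → E), IsQuotientCoveringMap q G ∧ Finite G ∧ PathConnectedSpace Y ∧
        Continuous f ∧ Function.Surjective f ∧ p ∘ f = q := by
  -- a point over `x₀`: move any point of `E` along (a lift of) a path to `x₀`
  obtain ⟨e₁⟩ := (inferInstance : PathConnectedSpace E).nonempty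
  let e₀ : p ⁻¹' {x₀} := hp.monodromy ⟦PathConnectedSpace.somePath (p e₁) x₀⟧ ⟨e₁, rfl⟩
  have he₀ : p (e₀ : E) = x₀ := e₀.2
  let N : Subgroup (FundamentalGroup X x₀) := (hp.monodromyPerm x₀).ker
  haveI : N.FiniteIndex := inferInstance
  let pbar : orbitRel.Quotient N (UniversalCover X x₀) → X :=
    Quotient.lift UniversalCover.proj fun a b h ↦ by
      obtain ⟨n, rfl⟩ := MulAction.mem_orbit_iff.mp h
      exact UniversalCover.proj_smul _ _
  have hpbar : ∀ a, pbar (Quotient.mk _ a) = UniversalCover.proj a := fun _ ↦ rfl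
  obtain ⟨f, hpf, -, hsurj⟩ := UniversalCover.exists_map_orbitQuotient_ker_monodromyPerm hp he₀ hpbar
  exact ⟨orbitRel.Quotient N (UniversalCover X x₀), inferInstance, FundamentalGroup X x₀ ⧸ N,
    inferInstance, inferInstance, pbar, f, UniversalCover.isQuotientCoveringMap_orbitLift N hpbar,
    inferInstance, inferInstance, f.continuous, hsurj, hpf⟩

end Literature.Topology.CoveringSpaces

end
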